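import Literature.IUT.HodgeArakelov.StableCurveAgreementOfCompletions
import Literature.IUT.HodgeArakelov.PlusMinusTowerCoverModel
import Literature.AnabelianGeometry.SemiGraphs.TemperedCompletionRestrict
import HarnessLib

/-!
# B15 piece 3, TOWER SIDE: `Π̂^±_v` of the genuine tower `ofCoverModel` / `ofPiCHat` IS a profinite completion of `Π^±_v` through `emb`

S. Mochizuki, *Inter-universal Teichmüller Theory II*, kurims manuscript (Dec. 2020), §2, Def 2.3 (i) p. 67 («`Π̂^±_v := Π̂_{X_v}`», the
profinite completion of `Π^±_v = Π^tp_{X_v}`); [SemiAnbd] §6 p. 69 («`∧` denotes profinite completion, or, equivalently, closure in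
`Π_{X_K}`»; here: closure in `Π̂_C`) [cite: Mochizuki2012, II Def 2.3 (i) p.67] [cite: MochizukiSemiAnbd2006, §6 p.69].  abc-iut cell,
MERGE-MAP row **B15** piece 3 (holder abc-iut-w5-d132 gen 4): the TOWER-SIDE hypotheses (a) «`embHat` is a profinite completion» and
«`aug|Π̂^±_v` continuous» of this seat's `StableCurveAgreement.exists_of_isProfiniteCompletion` (p430970), DISCHARGED for abc-iut-L6-t19's
genuine tower (B14, `PlusMinusTowerCoverModel.lean` p430122).  PROOF-ONLY (no `def`; the bundled map `embHat` is produced inside an `∃`).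

* `PlusMinusTower.exists_embHat_ofCoverModel` — for the parametric tower over ANY injective profinite completion `ι : Π^tp_C → Q`:
  `∃ embHat : Π^tp_{X_v}(P) →ₜ* Π̂^±_v, (embHat = emb on the nose) ∧ IsProfiniteCompletion embHat` — because `inclX(Π^tp_{X̲_v}) ≤ Π^tp_C`
  is OPEN of index `2l` (abc-iut-L2-d3 `isOpenEmbedding_inclX`, abc-iut-L6-t19 `index_map_inclX_GtpXu`), so abc-iut-L2-d1's
  «closure = completion» (`IsProfiniteCompletion.exists_restrict_of_isOpen_of_finiteIndex`) applies, transported along the source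
  isomorphism `Π^tp_{X_v}(P) ≅ Π^tp_{X̲_v} ≅ inclX(Π^tp_{X̲_v})` (`plainIso`, `inclX` an embedding) by `comp_continuousMulEquiv_source` (p430970);
* `PlusMinusTower.exists_embHat_ofPiCHat`, `PlusMinusTower.continuous_aug_pmHat_ofPiCHat` — the tower of record inside abc-iut-L2-d3's `Π_C`.

Nothing of the series is asserted; no side taken on [IUTchIII] Cor 3.12.
-/

noncomputable section

namespace Literature.IUT.HodgeArakelov

open Literature.AnabelianGeometry.EtaleTheta Literature.AnabelianGeometry.SemiGraphs
open scoped Pointwise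

namespace PlusMinusTower

variable {p : ℕ} [Fact p.Prime] {M : MuTwoSetting p} (e : M.CLevelData)
  {E : M.toThetaSetting.EtaleThetaData} {l : ℕ} (C : E.DoubleUnderline l) {N : ℕ+}
  (μ : M.toThetaSetting.CyclotomeMod l N) (hC : M.toThetaSetting.Compat) (hS : M.toThetaSetting.Sec2Hyps)
  (hl : l.Prime) (hp2 : p ≠ 2) (hpl : p ≠ l) (hζ : ∃ ζ : M.toThetaSetting.K, IsPrimitiveRoot ζ (4 * l))
  {η : (C.thetaEnvData μ hC hS).PiYdd → MuN p N} (hη : η ∈ (C.thetaEnvData μ hC hS).thetaCocycles)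
  {Q : Type} [Group Q] [TopologicalSpace Q] [IsTopologicalGroup Q]
  (ι : M.GtpC →ₜ* Q) (hι : IsProfiniteCompletion ι) (hinj : Function.Injective ι)
  (Φ : Q →* GQp p) (hΦ : ∀ g : M.GtpC, Φ (ι g) = e.augC g) (hΦK : Φ.range = M.GK)
  (hZ : Thm16Sub.KerToZIsCompactlyGenerated M.toThetaSetting) (hN : (C.Huu.subgroupOf (M.GtpXu l)).Normal)
  {P : TopGroup.{0}} (T : TemperedCoverings (BadPlaceSetting.ofUnderline C μ hC hS hl hp2 hpl hζ hη) P)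

include e in
omit [IsTopologicalGroup Q] in
/-- `inclX(Π^tp_{X̲_v}) ≤ Π^tp_C` is open (`inclX` an open embedding, `Π^tp_{X̲_v}` open in `Π^tp_X`). [cite: MochizukiEtTh2009, Def 2.1 p.36] -/
theorem isOpen_map_inclX_GtpXu (l : ℕ) : IsOpen (((M.GtpXu l).map M.inclX : Subgroup M.GtpC) : Set M.GtpC) := by
  rw [Subgroup.coe_map]
  exact e.isOpenEmbedding_inclX.isOpenMap _ (M.toThetaSetting.isOpen_GtpXu l)

include e in
omit [IsTopologicalGroup Q] in
/-- `Π^tp_{X̲_v} ≅ inclX(Π^tp_{X̲_v})` as TOPOLOGICAL groups (`inclX` is an embedding: the inverse is continuous by abc-iut-L2-d3's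
`continuous_ofInjective_symm`).  Existence form (no `def`). [cite: MochizukiEtTh2009, Def 2.1 p.36] -/
theorem exists_continuousMulEquiv_GtpXu_map (l : ℕ) :
    ∃ κ : ↥(M.GtpXu l) ≃ₜ* ↥((M.GtpXu l).map M.inclX), ∀ y, ((κ y : (M.GtpXu l).map M.inclX) : M.GtpC) = M.inclX y := by
  let κ₀ : ↥(M.GtpXu l) ≃* ↥((M.GtpXu l).map M.inclX) := Subgroup.equivMapOfInjective _ M.inclX M.injective_inclX
  have hκ₀ : ∀ y, ((κ₀ y : (M.GtpXu l).map M.inclX) : M.GtpC) = M.inclX y := fun _ => rfl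
  have hcont : Continuous κ₀ :=
    ((M.continuous_inclX.comp continuous_subtype_val).subtype_mk _)
  have hcont' : Continuous κ₀.symm := by
    -- `κ₀.symm z = ⟨ofInjective⁻¹ ⟨z, _⟩, _⟩`: continuity from `continuous_ofInjective_symm`
    have hval : Continuous fun z : ↥((M.GtpXu l).map M.inclX) => ((κ₀.symm z : M.GtpXu l) : M.PiTemp) := by
      have hfun : (fun z : ↥((M.GtpXu l).map M.inclX) => ((κ₀.symm z : M.GtpXu l) : M.PiTemp)) =
          (fun z : ↥((M.GtpXu l).map M.inclX) => (MonoidHom.ofInjective M.injective_inclX).symm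
            ⟨(z : M.GtpC), Subgroup.map_le_range _ _ z.2⟩) := by
        funext z
        apply M.injective_inclX
        rw [MonoidHom.apply_ofInjective_symm]
        change M.inclX ((κ₀.symm z : M.GtpXu l) : M.PiTemp) = (z : M.GtpC)
        rw [← hκ₀, MulEquiv.apply_symm_apply]
      rw [hfun]
      exact e.continuous_ofInjective_symm.comp (continuous_subtype_val.subtype_mk _)
    exact hval.subtype_mk _
  exact ⟨{ κ₀ with continuous_toFun := hcont, continuous_invFun := hcont' }, hκ₀⟩

include hι hinj in
/-- **`Π̂^±_v` IS a profinite completion of `Π^±_v` through `emb`** for the parametric genuine tower `ofCoverModel`: there is a continuous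
homomorphism `embHat : Π^tp_{X_v}(P) → Π̂^±_v` equal to `emb` on the nose which is a profinite completion — «closure in `Π̂_C` = completion»
for the open index-`2l` subgroup `inclX(Π^tp_{X̲_v}) ≤ Π^tp_C` (abc-iut-L2-d1 `exists_restrict_of_isOpen_of_finiteIndex`), transported along
`plainIso` and `inclX`.  PROVED. ([IUTchII] Def 2.3 (i), kurims p.67) [cite: Mochizuki2012, II Def 2.3 (i) p.67] [cite: MochizukiSemiAnbd2006, §6 p.69] -/
theorem exists_embHat_ofCoverModel :
    ∃ embHat : T.Xplain →ₜ* ↥(ofCoverModel e C μ hC hS hl hp2 hpl hζ hη ι hι hinj Φ hΦ hΦK hZ hN T).pmHat,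
      (∀ x, ((embHat x : (ofCoverModel e C μ hC hS hl hp2 hpl hζ hη ι hι hinj Φ hΦ hΦK hZ hN T).pmHat) :
          (ofCoverModel e C μ hC hS hl hp2 hpl hζ hη ι hι hinj Φ hΦ hΦK hZ hN T).Corhat) =
        (ofCoverModel e C μ hC hS hl hp2 hpl hζ hη ι hι hinj Φ hΦ hΦK hZ hN T).emb x) ∧
      IsProfiniteCompletion embHat := by
  -- the open finite-index subgroup `U := inclX(Π^tp_{X̲_v})` of `Π^tp_C` and L2-d1's restricted completion
  haveI : ((M.GtpXu l).map M.inclX).FiniteIndex :=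
    ⟨by rw [MuTwoSetting.index_map_inclX_GtpXu l M]; exact mul_ne_zero two_ne_zero C.l_ne_zero⟩
  obtain ⟨ιU, hιU, hιUc⟩ := hι.exists_restrict_of_isOpen_of_finiteIndex ((M.GtpXu l).map M.inclX)
    (isOpen_map_inclX_GtpXu e l)
  obtain ⟨κ, hκ⟩ := exists_continuousMulEquiv_GtpXu_map e l
  -- the source isomorphism `Π^tp_{X_v}(P) ≅ Π^tp_{X̲_v} ≅ inclX(Π^tp_{X̲_v})`
  let ψ : T.Xplain ≃ₜ* ↥((M.GtpXu l).map M.inclX) := T.plainIso.trans κ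
  let embHat : T.Xplain →ₜ* ↥((((M.GtpXu l).map M.inclX).map ι.toMonoidHom).topologicalClosure) :=
    ιU.comp ⟨ψ.toMulEquiv.toMonoidHom, ψ.continuous⟩
  refine ⟨embHat, fun x => ?_, IsProfiniteCompletion.comp_continuousMulEquiv_source hιUc ψ embHat fun _ => rfl⟩
  change ((ιU (ψ x) : (((M.GtpXu l).map M.inclX).map ι.toMonoidHom).topologicalClosure) : Q) =
    coverModelEmb C μ hC hS hl hp2 hpl hζ hη ι T x
  rw [hιU, coverModelEmb_apply]
  change ι ((κ (T.plainIso x) : (M.GtpXu l).map M.inclX) : M.GtpC) = ι (M.inclX (T.plainIso x).1)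
  rw [hκ]

/-- **The tower of record `ofPiCHat`: `Π̂^±_v ⊆ Π_C` is a profinite completion of `Π^±_v` through `emb`** (instance of
`exists_embHat_ofCoverModel` at abc-iut-L2-d3's `toPiCHat`).  ([IUTchII] Def 2.3 (i), kurims p.67) [cite: Mochizuki2012, II Def 2.3 (i) p.67] -/
theorem exists_embHat_ofPiCHat :
    ∃ embHat : T.Xplain →ₜ* ↥(ofPiCHat e C μ hC hS hl hp2 hpl hζ hη hZ hN T).pmHat,
      (∀ x, ((embHat x : (ofPiCHat e C μ hC hS hl hp2 hpl hζ hη hZ hN T).pmHat) :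
          (ofPiCHat e C μ hC hS hl hp2 hpl hζ hη hZ hN T).Corhat) = (ofPiCHat e C μ hC hS hl hp2 hpl hζ hη hZ hN T).emb x) ∧
      IsProfiniteCompletion embHat :=
  exists_embHat_ofCoverModel e C μ hC hS hl hp2 hpl hζ hη e.toPiCHat e.isProfiniteCompletion_toPiCHat e.toPiCHat_injective
    e.piCData.aug.toMonoidHom (fun g => e.piCData_aug_apply g) e.piCData.range_aug hZ hN T

/-- The augmentation of the tower of record is continuous on `Π̂^±_v` (`piCData.aug` is continuous).
([IUTchII] Def 2.3 (i), kurims p.67) [cite: Mochizuki2012, II Def 2.3 (i) p.67] -/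
theorem continuous_aug_pmHat_ofPiCHat :
    Continuous ((ofPiCHat e C μ hC hS hl hp2 hpl hζ hη hZ hN T).aug.comp
      (ofPiCHat e C μ hC hS hl hp2 hpl hζ hη hZ hN T).pmHat.subtype) := by
  change Continuous fun g : ↥(ofPiCHat e C μ hC hS hl hp2 hpl hζ hη hZ hN T).pmHat =>
    coverModelAug C μ hC hS hl hp2 hpl hζ hη e.piCData.aug.toMonoidHom e.piCData.range_aug g.1
  exact (e.piCData.aug.continuous.subtype_mk _).comp continuous_subtype_val

end PlusMinusTower

end Literature.IUT.HodgeArakelov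

end
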